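import Summits.QuantumFields.BalabanUV.T4Continuum.Support.VariationalCovariantScalarPair

/-!
# T⁴ programme, spine node NE2 (U1a), lane P2 — SUPPLIER LEAF s8 «L-LIP»: THE TWO-RUNS FACE OF THE SCALAR COVARIANT BRACKET,
# ADDITIVE FORM — `|Δ′(W′)(μ) − Δ′(W)(μ)| ≤ (2δ√(ΛC_P(Λ+1)) + δ²C_P(Λ+1))·‖μ‖²`, `δ = √d·n·ρ`, `ρ` = the aligned-connection distance

NE2 formalisation swarm `b2b-balaban-t4-ne2-formalise-*`, seat leaf 07 (gen 2), supplier leaf s8 of the P2 skeleton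
`t4/skeletons/NE2-t4-ne2-p2.md` v0.6 §7 («TWO-RUNS FACE: L-LIP ‖Δ′_k(W) − Δ′_k(W′)‖_op ≤ C_Lip·‖w − w′‖_{C¹,unit} (variational: |Sc_W(λ) −
Sc_{W′}(λ)| ≤ 2‖w−w′‖_∞√Sc·‖λ‖n + …, constraint transfer Qk(T_W) ↔ Qk(T_{W′})); NEW as displayed; OPEN · M»), on the owner's carriers
(`VariationalCovariantScalarPair`: `Sc`, `qW`, `Qk`; `VariationalCovariantFederbush`: `cD`, `dirU`, `Qc`; `VariationalTransfer.blockSpin`).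

WHAT IS PROVED (model level; King's U(1) charged scalar; bond phases and site transports are DATA).
 * §1 ABSTRACT «Lipschitz half»: for two coarse data `(Qk, Sc)`, `(Qk′, Sc′)` on the same carrier and a re-phasing map `Φ` with EXACT
   constraint transfer `Qk′ (Φ f) = Qk f` and the form comparison `Sc′ (Φ f) ≤ (√(Sc f) + δ·√(qW f))²`, leaf UB⁺ (`Λ`) and leaf P⁺ (`C_P`) for
   the unprimed datum give **`lipschitz_half`**: `T_{Qk′}Sc′ (μ) ≤ T_{Qk}Sc (μ) + (2δ√(Λ·C_P(Λ+1)) + δ²·C_P(Λ+1))·qZ μ` — the SAME defect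
   polynomial as the FED⁺ face of `VariationalCovariantAssembly.pair_bracket` (minimiser by compactness, `defect_bound`); no KKT.
 * §2 CONCRETE, level `n`: the site-phase ratio `u = conj T′ · T` (`phaseRatio`), the re-phased field `u·f` (`rephase`) and the ALIGNED
   connection `R̃(y,μ) = conj(u y)·R′(y,μ)·u(y+e_μ)` (`aligned`): (i) **`Qk_rephase`** `Q_{T′}(u·f) = Q_T f` (exact constraint transfer,
   `|T′| = 1`); (ii) **`Sc_rephase`** `Sc_{R′}(u·f) = Sc_{R̃}(f)` (exact gauge covariance of the covariant Dirichlet form, `|u| = 1`);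
   (iii) **`Sc_perturb`** `Sc_{R₁}(f) ≤ (√Sc_{R₂}(f) + √d·(n·ρ)·√qW(f))²` whenever `|R₁ − R₂| ≤ ρ` pointwise — one bond-phase perturbation,
   Minkowski in `y`, Cauchy–Schwarz in `μ` (the owner's `sum_sq_add_le` / `sum_fin_sq_add_le`), the physical-units scaling of `Sc_Q1_le`.
 * §3 **`scalar_lipschitz_half`** / **`scalar_lipschitz_bracket`**: for two backgrounds `W = (R, T)`, `W′ = (R′, T′)` at the SAME level with
   unit-modulus site transports, UB⁺ and P⁺ (in the shapes `pair_bracket`/`scalar_pair_bracket` use) and the ONE displayed number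
   `ρ ≥ sup_{y,μ} |R̃(y,μ) − R(y,μ)|` (aligned-connection distance; for the reverse half the symmetric datum `ρ′`):
   `|Δ′(W′)(μ) − Δ′(W)(μ)| ≤ e_L·nsq μ`, `e_L = 2δ√(Λ·C_P(Λ+1)) + δ²·C_P(Λ+1)`, `δ = √d·(n·ρ)`;
   **`norm_aligned_symm`**: `ρ′ = ρ` pointwise (the aligned-connection distance is symmetric for unit-modulus site transports), hence
   **`scalar_lipschitz_abs`** with ONE number `ρ`; **`scalar_lipschitz_half_frame`**: the same with P⁺ DISCHARGED from the owner's `qW_le_coarse` (global small-field frame data), `C_P = 1088d + 128`;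
   **`opNorm_lipschitz`** / **`opNorm_scalar_lipschitz`**: the op-norm form `‖X′ − X‖ ≤ e_L` for Hermitian matrices representing the two
   effective actions (`VariationalAdditive.opNorm_sub_le_of_form_abs`; the matrix READING itself is supplier leaf s1, a displayed hypothesis).
READING (not asserted): for Bałaban's two runs `W = U_k(V)`, `W′ = Q̄(U_{k+1}(V))` the number `n·ρ` is the unit-lattice distance of the two
connections after aligning the (1.7)-leg site transports — the currency of node NE3 (`T4EtaRateMin.LocalRate`, P1's `Support/NE2FromNE3`); that
identification is the owner's two-runs wiring, NOT this file.

HONEST FRAMING (T4-DAG p. 1).  Model level: phases/transporters DATA, no claim that they are Bałaban's minimisers or averages (no B0); scalar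
U(1) sector (the colour version is the same algebra with unitary matrices — not claimed); `ρ`, `Λ`, `C_P` displayed; NOT NE2⁺, NE2 NOT proved;
finite torus; spine 0/9 unchanged; rung (B)+1 — NOT infinite volume, NOT a mass gap, NOT Clay, NOT summit progress.  HONEST DEPENDENCY:
continuum YM on T⁴ ⇐ BetaPertH ∧ nine spine estimates (0/9 proved); BetaPertH ⇐ (D1) ∧ (D4) ∧ CAP+tail; G-an2-4 gates asym, D1 and NE2/3/4.
ABSOLUTE RULE kept (nothing printed is a hypothesis; every `[cite:]` a SHAPE locator); no `def … : Prop`; no `sorry`.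
-/

noncomputable section

open scoped Matrix Matrix.Norms.L2Operator

namespace Summit.QuantumFields.BalabanUV.T4Continuum.VariationalCovariantLipschitz

open Finset
open Literature.MathematicalPhysics.QuantumFieldTheory.Balaban1983to89
open Literature.MathematicalPhysics.QuantumFieldTheory.Balaban1983to89.B5Prop11Plancherel (Tor fine unitVec)
open Literature.MathematicalPhysics.QuantumFieldTheory.Balaban1983to89.B5Prop11Lower (nsq nsq_nonneg)
open Literature.MathematicalPhysics.QuantumFieldTheory.Balaban1983to89.B5Block118 (bpt)
open Summit.QuantumFields.BalabanUV.T4Continuum.VariationalTransfer (blockSpin blockSpin_le blockSpin_eq_of_isMin)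
open Summit.QuantumFields.BalabanUV.T4Continuum.VariationalAdditive (opNorm_sub_le_of_form_abs)
open Summit.QuantumFields.BalabanUV.T4Continuum.VariationalCovariantFederbush (cD dirU Qc dirU_nonneg sum_sq_add_le sum_fin_sq_add_le)
open Summit.QuantumFields.BalabanUV.T4Continuum.VariationalCovariantAssembly (exists_isMinOn_fib defect_bound)
open Summit.QuantumFields.BalabanUV.T4Continuum.VariationalCovariantScalarPair (Sc qW Qk Sc_nonneg qW_nonneg norm_sq_le_qW continuous_Qc
  continuous_sum_dirU qW_le_coarse)

/-! ## §1 The abstract Lipschitz half: re-phasing with exact constraint transfer and a perturbed form -/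

section Abstract

variable {W Z : Type*} [NormedAddCommGroup W] [ProperSpace W] [TopologicalSpace Z] [T1Space Z]

/-- **THE LIPSCHITZ HALF OF THE TWO-RUNS FACE, ABSTRACT** (kernel of leaf s8): coarse data `(Qk, Sc)` and `(Qk′, Sc′)` on one carrier, a
re-phasing `Φ` with EXACT constraint transfer `Qk′ ∘ Φ = Qk` and `Sc′ (Φ f) ≤ (√(Sc f) + δ·√(qW f))²`, leaves UB⁺ (`Λ`) and P⁺ (`C_P`) for
`(Qk, Sc)` ⟹ `T_{Qk′}Sc′(μ) ≤ T_{Qk}Sc(μ) + (2δ√(Λ·C_P(Λ+1)) + δ²·C_P(Λ+1))·qZ μ`.  The competitor for the primed problem is `Φ` of the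
unprimed minimiser (which exists by compactness from P⁺). [folklore] -/
theorem lipschitz_half {Qk Qk' : W → Z} {Sc Sc' qW : W → ℝ} {qZ : Z → ℝ} (Φ : W → W)
    (hQk : Continuous Qk) (hSc : Continuous Sc) (hSc0 : ∀ f, 0 ≤ Sc f) (hSc'0 : ∀ f, 0 ≤ Sc' f) (hqW0 : ∀ f, 0 ≤ qW f)
    (hqZ0 : ∀ μ, 0 ≤ qZ μ) {κ Λ CP δ : ℝ} (hκ : 0 ≤ κ) (hΛ : 0 ≤ Λ) (hCP : 0 ≤ CP) (hδ : 0 ≤ δ)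
    (hnormW : ∀ f, ‖f‖ ^ 2 ≤ κ * qW f)
    (hUB : ∀ μ, ∃ f, Qk f = μ ∧ Sc f ≤ Λ * qZ μ) (hP : ∀ f, qW f ≤ CP * (Sc f + qZ (Qk f)))
    (hΦQ : ∀ f, Qk' (Φ f) = Qk f) (hΦS : ∀ f, Sc' (Φ f) ≤ (Real.sqrt (Sc f) + δ * Real.sqrt (qW f)) ^ 2) (μ : Z) :
    blockSpin Qk' Sc' μ ≤ blockSpin Qk Sc μ + (2 * δ * Real.sqrt (Λ * (CP * (Λ + 1))) + δ ^ 2 * (CP * (Λ + 1))) * qZ μ := by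
  -- the unprimed minimiser (P⁺ coercivity + UB⁺ nonemptiness)
  obtain ⟨fU, hfU, hfUb⟩ := hUB μ
  obtain ⟨f₀, hf₀, hmin⟩ := exists_isMinOn_fib (qZ := qZ) hQk hSc hκ hCP hnormW hP hfU
  have hval : blockSpin Qk Sc μ = Sc f₀ := blockSpin_eq_of_isMin hSc0 hf₀ hmin
  have hSc_le : Sc f₀ ≤ Λ * qZ μ := (hmin fU hfU).trans hfUb
  have hqW_le : qW f₀ ≤ CP * (Λ + 1) * qZ μ := by
    calc qW f₀ ≤ CP * (Sc f₀ + qZ (Qk f₀)) := hP f₀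
      _ ≤ CP * (Λ * qZ μ + qZ μ) := by rw [hf₀]; gcongr
      _ = CP * (Λ + 1) * qZ μ := by ring
  -- the competitor `Φ f₀` for the primed problem
  have hcomp : blockSpin Qk' Sc' μ ≤ Sc' (Φ f₀) := blockSpin_le hSc'0 (by rw [hΦQ, hf₀])
  have h := hΦS f₀
  have hdef := defect_bound (s := Sc f₀) (v := qW f₀) (z := qZ μ) (P := CP * (Λ + 1)) hδ hΛ (by positivity) (hqZ0 μ) hSc_le hqW_le
  rw [add_sq, Real.sq_sqrt (hSc0 f₀), mul_pow, Real.sq_sqrt (hqW0 f₀)] at h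
  rw [hval]
  linarith

end Abstract

/-! ## §2 King's charged scalar at one level: re-phasing, aligned connection, one bond-phase perturbation -/

section OneLevel

variable {d : ℕ} (N : Fin d → ℕ) [∀ μ, NeZero (N μ)]

/-- the SITE-PHASE RATIO of two site transports: `u = conj T′ · T`. [folklore] -/
def phaseRatio (T T' : Tor N → ℂ) (x : Tor N) : ℂ := (starRingEnd ℂ) (T' x) * T x

/-- the RE-PHASED field `u·f`. [folklore] -/
def rephase (u : Tor N → ℂ) (f : Tor N → ℂ) : Tor N → ℂ := fun x => u x * f x

/-- the ALIGNED connection `R̃(y,μ) = conj(u y)·R′(y,μ)·u(y + e_μ)` (the primed bond phases read in the unprimed site frame).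
[cite: Balaban1985BackgroundPropagators, (3.3) p.390 (shape; abelian gauge transformation of a lattice connection)] [folklore] -/
def aligned (u : Tor N → ℂ) (R' : Tor N → Fin d → ℂ) : Tor N → Fin d → ℂ :=
  fun y μ => (starRingEnd ℂ) (u y) * R' y μ * u (y + unitVec N μ)

omit [∀ μ, NeZero (N μ)] in
/-- `|u| = 1` for unit-modulus site transports. [folklore] -/
theorem norm_phaseRatio {T T' : Tor N → ℂ} (hT : ∀ x, ‖T x‖ = 1) (hT' : ∀ x, ‖T' x‖ = 1) (x : Tor N) :
    ‖phaseRatio N T T' x‖ = 1 := by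
  rw [phaseRatio, norm_mul, Complex.norm_conj, hT, hT', one_mul]

omit [∀ μ, NeZero (N μ)] in
/-- `T′·u = T` (`|T′| = 1`). [folklore] -/
theorem mul_phaseRatio {T T' : Tor N → ℂ} (hT' : ∀ x, ‖T' x‖ = 1) (x : Tor N) : T' x * phaseRatio N T T' x = T x := by
  have h1 : T' x * (starRingEnd ℂ) (T' x) = 1 := (by rw [Complex.mul_conj, Complex.normSq_eq_norm_sq, hT' x, one_pow, Complex.ofReal_one])
  rw [phaseRatio, ← mul_assoc, h1, one_mul]

omit [∀ μ, NeZero (N μ)] in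
/-- **(ii) EXACT GAUGE COVARIANCE OF THE COVARIANT DIFFERENCE**: `D_{R′}(u·f)(y,μ) = u(y)·D_{R̃} f (y,μ)` for `|u(y)| = 1`. [folklore] -/
theorem cD_rephase {u : Tor N → ℂ} (hu : ∀ y, ‖u y‖ = 1) (R' : Tor N → Fin d → ℂ) (f : Tor N → ℂ) (y : Tor N) (μ : Fin d) :
    cD N R' (rephase N u f) y μ = u y * cD N (aligned N u R') f y μ := by
  have h1 : u y * (starRingEnd ℂ) (u y) = 1 := (by rw [Complex.mul_conj, Complex.normSq_eq_norm_sq, hu y, one_pow, Complex.ofReal_one])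
  simp only [cD, rephase, aligned]
  calc R' y μ * (u (y + unitVec N μ) * f (y + unitVec N μ)) - u y * f y
      = (u y * (starRingEnd ℂ) (u y)) * R' y μ * u (y + unitVec N μ) * f (y + unitVec N μ) - u y * f y := by rw [h1]; ring
    _ = u y * ((starRingEnd ℂ) (u y) * R' y μ * u (y + unitVec N μ) * f (y + unitVec N μ) - f y) := by ring

omit [∀ μ, NeZero (N μ)] in
/-- the reversed phase ratio is the conjugate: `conj T·T′ = conj(conj T′·T)`. [folklore] -/
theorem phaseRatio_swap (T T' : Tor N → ℂ) (x : Tor N) : phaseRatio N T' T x = (starRingEnd ℂ) (phaseRatio N T T' x) := by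
  simp only [phaseRatio, map_mul, Complex.conj_conj, mul_comm]

omit [∀ μ, NeZero (N μ)] in
/-- **THE ALIGNED-CONNECTION DISTANCE IS SYMMETRIC IN THE TWO BACKGROUNDS** (unit-modulus site transports; NO unit-modulus assumption on
the bond phases): `|R̃′ − R′| = |R̃ − R|` pointwise, where `R̃` reads `R′` in `W`'s frame and `R̃′` reads `R` in `W′`'s frame — so ONE number
`ρ` serves both halves of the bracket. [folklore] -/
theorem norm_aligned_symm {T T' : Tor N → ℂ} (hT : ∀ x, ‖T x‖ = 1) (hT' : ∀ x, ‖T' x‖ = 1) (R R' : Tor N → Fin d → ℂ) (y : Tor N)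
    (μ : Fin d) :
    ‖aligned N (phaseRatio N T' T) R y μ - R' y μ‖ = ‖aligned N (phaseRatio N T T') R' y μ - R y μ‖ := by
  set u : Tor N → ℂ := phaseRatio N T T' with hu_def
  have hu : ∀ x, ‖u x‖ = 1 := norm_phaseRatio N hT hT'
  have h1 : u y * (starRingEnd ℂ) (u y) = 1 := (by rw [Complex.mul_conj, Complex.normSq_eq_norm_sq, hu y, one_pow, Complex.ofReal_one])
  have h2 : u (y + unitVec N μ) * (starRingEnd ℂ) (u (y + unitVec N μ)) = 1 :=
    (by rw [Complex.mul_conj, Complex.normSq_eq_norm_sq, hu _, one_pow, Complex.ofReal_one])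
  have hsw : ∀ x, phaseRatio N T' T x = (starRingEnd ℂ) (u x) := fun x => phaseRatio_swap N T T' x
  have key : (starRingEnd ℂ) (u y) * (aligned N (phaseRatio N T' T) R y μ - R' y μ) * u (y + unitVec N μ)
      = R y μ - aligned N u R' y μ := by
    simp only [aligned, hsw, Complex.conj_conj]
    linear_combination (R y μ * (u y * (starRingEnd ℂ) (u y))) * h2 + (R y μ) * h1
  have hn : ‖(starRingEnd ℂ) (u y) * (aligned N (phaseRatio N T' T) R y μ - R' y μ) * u (y + unitVec N μ)‖
      = ‖aligned N (phaseRatio N T' T) R y μ - R' y μ‖ := by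
    rw [norm_mul, norm_mul, Complex.norm_conj, hu, hu, one_mul, mul_one]
  rw [← hn, key, norm_sub_rev]

/-- hence the directional Dirichlet sums agree: `dirU R′ (u·f) μ = dirU R̃ f μ`. [folklore] -/
theorem dirU_rephase {u : Tor N → ℂ} (hu : ∀ y, ‖u y‖ = 1) (R' : Tor N → Fin d → ℂ) (f : Tor N → ℂ) (μ : Fin d) :
    dirU N R' (rephase N u f) μ = dirU N (aligned N u R') f μ := by
  unfold dirU
  refine sum_congr rfl fun y _ => ?_
  rw [cD_rephase N hu, norm_mul, hu y, one_mul]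

omit [∀ μ, NeZero (N μ)] in
/-- one bond-phase perturbation of the covariant difference: `D_{R₁}f − D_{R₂}f = (R₁ − R₂)·f(· + e_μ)`. [folklore] -/
theorem cD_sub_cD (R₁ R₂ : Tor N → Fin d → ℂ) (f : Tor N → ℂ) (y : Tor N) (μ : Fin d) :
    cD N R₁ f y μ - cD N R₂ f y μ = (R₁ y μ - R₂ y μ) * f (y + unitVec N μ) := by
  simp only [cD]; ring

/-- the translated `ℓ²` mass: `Σ_y |f(y + v)|² = nsq f`. [folklore] -/
theorem sum_norm_sq_translate (f : Tor N → ℂ) (v : Tor N) : ∑ y, ‖f (y + v)‖ ^ 2 = nsq f :=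
  Equiv.sum_comp (Equiv.addRight v) (fun x => ‖f x‖ ^ 2)

/-- **(iii) ONE BOND-PHASE PERTURBATION OF THE DIRECTIONAL DIRICHLET SUM**: `|R₁ − R₂| ≤ ρ` pointwise ⟹
`dirU R₁ f μ ≤ (√(dirU R₂ f μ) + ρ·√(nsq f))²` (Minkowski in `y`). [folklore] -/
theorem dirU_perturb {R₁ R₂ : Tor N → Fin d → ℂ} {ρ : ℝ} (hρ0 : 0 ≤ ρ) (hρ : ∀ y μ, ‖R₁ y μ - R₂ y μ‖ ≤ ρ) (f : Tor N → ℂ)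
    (μ : Fin d) : dirU N R₁ f μ ≤ (Real.sqrt (dirU N R₂ f μ) + ρ * Real.sqrt (nsq f)) ^ 2 := by
  have hpt : ∀ y, ‖cD N R₁ f y μ‖ ≤ ‖cD N R₂ f y μ‖ + ρ * ‖f (y + unitVec N μ)‖ := by
    intro y
    have e : cD N R₁ f y μ = cD N R₂ f y μ + (R₁ y μ - R₂ y μ) * f (y + unitVec N μ) := by
      rw [← cD_sub_cD]; ring
    rw [e]
    refine (norm_add_le _ _).trans (add_le_add le_rfl ?_)
    rw [norm_mul]
    exact mul_le_mul_of_nonneg_right (hρ y μ) (norm_nonneg _)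
  have h1 : dirU N R₁ f μ ≤ ∑ y, (‖cD N R₂ f y μ‖ + ρ * ‖f (y + unitVec N μ)‖) ^ 2 := by
    unfold dirU
    refine sum_le_sum fun y _ => ?_
    exact pow_le_pow_left₀ (norm_nonneg _) (hpt y) 2
  refine h1.trans ((sum_sq_add_le univ (fun y => ‖cD N R₂ f y μ‖) (fun y => ‖f (y + unitVec N μ)‖) hρ0).trans (le_of_eq ?_))
  rw [sum_norm_sq_translate]
  rfl

/-- summed over directions (Cauchy–Schwarz in `μ`): `Σ_μ dirU R₁ f μ ≤ (√(Σ_μ dirU R₂ f μ) + √d·ρ·√(nsq f))²`. [folklore] -/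
theorem sum_dirU_perturb {R₁ R₂ : Tor N → Fin d → ℂ} {ρ : ℝ} (hρ0 : 0 ≤ ρ) (hρ : ∀ y μ, ‖R₁ y μ - R₂ y μ‖ ≤ ρ) (f : Tor N → ℂ) :
    ∑ μ, dirU N R₁ f μ ≤ (Real.sqrt (∑ μ, dirU N R₂ f μ) + Real.sqrt d * (ρ * Real.sqrt (nsq f))) ^ 2 := by
  have hb : 0 ≤ ρ * Real.sqrt (nsq f) := mul_nonneg hρ0 (Real.sqrt_nonneg _)
  have h1 : ∑ μ, dirU N R₁ f μ ≤ ∑ μ, (Real.sqrt (dirU N R₂ f μ) + ρ * Real.sqrt (nsq f)) ^ 2 :=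
    sum_le_sum fun μ _ => dirU_perturb N hρ0 hρ f μ
  refine h1.trans ((sum_fin_sq_add_le (fun μ => Real.sqrt (dirU N R₂ f μ)) hb).trans (le_of_eq ?_))
  congr 2
  exact congrArg Real.sqrt (sum_congr rfl fun μ _ => Real.sq_sqrt (dirU_nonneg N R₂ f μ))

end OneLevel

/-! ## §3 Physical units at level `n`: the re-phased constraint, the covariant form, the Lipschitz bracket -/

section LevelN

variable {d : ℕ} (n : ℕ) [NeZero n] (M : Fin d → ℕ) [hM : ∀ μ, NeZero (M μ)]

omit [NeZero n] hM in
/-- **(i) EXACT CONSTRAINT TRANSFER**: `Q_{T′}(u·f) = Q_T f` for `u = conj T′·T`, `|T′| = 1` — the re-phased field has the SAME transported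
block averages for the primed site transports as `f` has for the unprimed ones. [cite: Balaban1985BackgroundPropagators, (3.19) p.393 (shape)]
[folklore] -/
theorem Qk_rephase {T T' : Tor (fine n M) → ℂ} (hT' : ∀ x, ‖T' x‖ = 1) (f : Tor (fine n M) → ℂ) :
    Qk n M T' (rephase (fine n M) (phaseRatio (fine n M) T T') f) = Qk n M T f := by
  funext z
  simp only [Qk, Qc, rephase]
  congr 1
  refine sum_congr rfl fun j _ => ?_
  rw [← mul_assoc, mul_phaseRatio (fine n M) hT']

/-- **(ii) EXACT GAUGE COVARIANCE OF THE COVARIANT FORM**: `Sc_{R′}(u·f) = Sc_{R̃}(f)`, `|u| = 1`. [folklore] -/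
theorem Sc_rephase {u : Tor (fine n M) → ℂ} (hu : ∀ y, ‖u y‖ = 1) (R' : Tor (fine n M) → Fin d → ℂ) (f : Tor (fine n M) → ℂ) :
    Sc n M R' (rephase (fine n M) u f) = Sc n M (aligned (fine n M) u R') f := by
  unfold Sc
  congr 1
  exact sum_congr rfl fun μ _ => dirU_rephase (fine n M) hu R' f μ

/-- **(iii) ONE BOND-PHASE PERTURBATION OF THE COVARIANT FORM, PHYSICAL UNITS**: `|R₁ − R₂| ≤ ρ` pointwise ⟹
`Sc_{R₁}(f) ≤ (√Sc_{R₂}(f) + √d·(n·ρ)·√qW(f))²`. [folklore] -/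
theorem Sc_perturb {R₁ R₂ : Tor (fine n M) → Fin d → ℂ} {ρ : ℝ} (hρ0 : 0 ≤ ρ) (hρ : ∀ y μ, ‖R₁ y μ - R₂ y μ‖ ≤ ρ)
    (f : Tor (fine n M) → ℂ) :
    Sc n M R₁ f ≤ (Real.sqrt (Sc n M R₂ f) + Real.sqrt d * ((n : ℝ) * ρ) * Real.sqrt (qW n M f)) ^ 2 := by
  have hn : (0 : ℝ) < (n : ℝ) := by exact_mod_cast Nat.pos_of_ne_zero (NeZero.ne n)
  have hnd : (0 : ℝ) < (n : ℝ) ^ d := by positivity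
  set c : ℝ := (n : ℝ) ^ 2 / (n : ℝ) ^ d with hcdef
  have hc0 : 0 ≤ c := by positivity
  set D₂ : ℝ := ∑ μ, dirU (fine n M) R₂ f μ with hD₂
  set Y : ℝ := nsq f with hY
  have hD₂0 : 0 ≤ D₂ := sum_nonneg fun μ _ => dirU_nonneg _ _ _ _
  have h : ∑ μ, dirU (fine n M) R₁ f μ ≤ (Real.sqrt D₂ + Real.sqrt d * (ρ * Real.sqrt Y)) ^ 2 := sum_dirU_perturb (fine n M) hρ0 hρ f
  have hSc₁ : Sc n M R₁ f = c * ∑ μ, dirU (fine n M) R₁ f μ := rfl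
  have hSc₂ : Sc n M R₂ f = c * D₂ := rfl
  have hqW : qW n M f = ((n : ℝ) ^ d)⁻¹ * Y := rfl
  have e1 : Real.sqrt c * Real.sqrt D₂ = Real.sqrt (Sc n M R₂ f) := by rw [← Real.sqrt_mul hc0, hSc₂]
  have e2 : Real.sqrt c * (Real.sqrt d * (ρ * Real.sqrt Y)) = Real.sqrt d * ((n : ℝ) * ρ) * Real.sqrt (qW n M f) := by
    have h1 : Real.sqrt c * Real.sqrt Y = n * Real.sqrt (qW n M f) := by
      have e : c * Y = (n : ℝ) ^ 2 * qW n M f := by rw [hqW, hcdef]; field_simp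
      rw [← Real.sqrt_mul hc0, e, Real.sqrt_mul (sq_nonneg _), Real.sqrt_sq hn.le]
    calc Real.sqrt c * (Real.sqrt d * (ρ * Real.sqrt Y)) = Real.sqrt d * ρ * (Real.sqrt c * Real.sqrt Y) := by ring
      _ = _ := by rw [h1]; ring
  have hsq : Real.sqrt c ^ 2 = c := Real.sq_sqrt hc0
  have key : ∀ a b : ℝ, c * (a + b) ^ 2 = (Real.sqrt c * a + Real.sqrt c * b) ^ 2 := by
    intro a b
    calc c * (a + b) ^ 2 = Real.sqrt c ^ 2 * (a + b) ^ 2 := by rw [hsq]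
      _ = (Real.sqrt c * a + Real.sqrt c * b) ^ 2 := by ring
  calc Sc n M R₁ f = c * ∑ μ, dirU (fine n M) R₁ f μ := hSc₁
    _ ≤ c * (Real.sqrt D₂ + Real.sqrt d * (ρ * Real.sqrt Y)) ^ 2 := mul_le_mul_of_nonneg_left h hc0
    _ = (Real.sqrt c * Real.sqrt D₂ + Real.sqrt c * (Real.sqrt d * (ρ * Real.sqrt Y))) ^ 2 := key _ _
    _ = _ := by rw [e1, e2]

/-- the re-phased form against the unprimed one: `|u| = 1`, `|R̃ − R| ≤ ρ` ⟹ `Sc_{R′}(u·f) ≤ (√Sc_R(f) + √d·(n·ρ)·√qW(f))²`. [folklore] -/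
theorem Sc_rephase_le {u : Tor (fine n M) → ℂ} (hu : ∀ y, ‖u y‖ = 1) {R R' : Tor (fine n M) → Fin d → ℂ} {ρ : ℝ} (hρ0 : 0 ≤ ρ)
    (hρ : ∀ y μ, ‖aligned (fine n M) u R' y μ - R y μ‖ ≤ ρ) (f : Tor (fine n M) → ℂ) :
    Sc n M R' (rephase (fine n M) u f) ≤ (Real.sqrt (Sc n M R f) + Real.sqrt d * ((n : ℝ) * ρ) * Real.sqrt (qW n M f)) ^ 2 := by
  rw [Sc_rephase n M hu]
  exact Sc_perturb n M hρ0 hρ f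

/-- re-phasing by a unit-modulus `u` preserves the `L²` size. [folklore] -/
theorem qW_rephase {u : Tor (fine n M) → ℂ} (hu : ∀ y, ‖u y‖ = 1) (f : Tor (fine n M) → ℂ) :
    qW n M (rephase (fine n M) u f) = qW n M f := by
  unfold qW nsq rephase
  congr 1
  exact sum_congr rfl fun x _ => by rw [norm_mul, hu x, one_mul]

/-- **LEAF s8, ONE HALF — THE LIPSCHITZ BOUND OF THE SCALAR COVARIANT EFFECTIVE ACTION IN THE BACKGROUND** (model level, level `n`):
two backgrounds `W = (R, T)`, `W′ = (R′, T′)` with unit-modulus site transports; leaf UB⁺ (`Λ`) and leaf P⁺ (`C_P`) for `W` in the shapes of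
`scalar_pair_bracket`; and ONE displayed number `ρ ≥ sup |R̃ − R|`, `R̃(y,μ) = conj(u y)·R′(y,μ)·u(y+e_μ)`, `u = conj T′·T` ⟹ for every unit
datum `μ`: `Δ′(W′)(μ) ≤ Δ′(W)(μ) + (2δ√(Λ·C_P(Λ+1)) + δ²·C_P(Λ+1))·nsq μ`, `δ = √d·(n·ρ)`.  No KKT, no Fourier, no `k` inside; the
competitor is the `W`-minimiser re-phased by `u`. [folklore] -/
theorem scalar_lipschitz_half {R R' : Tor (fine n M) → Fin d → ℂ} {T T' : Tor (fine n M) → ℂ}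
    (hT : ∀ x, ‖T x‖ = 1) (hT' : ∀ x, ‖T' x‖ = 1) {ρ : ℝ} (hρ0 : 0 ≤ ρ)
    (hρ : ∀ y μ, ‖aligned (fine n M) (phaseRatio (fine n M) T T') R' y μ - R y μ‖ ≤ ρ)
    {Λ CP : ℝ} (hΛ : 0 ≤ Λ) (hCP : 0 ≤ CP)
    (hUB : ∀ μ : Tor M → ℂ, ∃ f, Qk n M T f = μ ∧ Sc n M R f ≤ Λ * nsq μ)
    (hP : ∀ f, qW n M f ≤ CP * (Sc n M R f + nsq (Qk n M T f))) (μ : Tor M → ℂ) :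
    blockSpin (Qk n M T') (Sc n M R') μ ≤ blockSpin (Qk n M T) (Sc n M R) μ
      + (2 * (Real.sqrt d * ((n : ℝ) * ρ)) * Real.sqrt (Λ * (CP * (Λ + 1)))
          + (Real.sqrt d * ((n : ℝ) * ρ)) ^ 2 * (CP * (Λ + 1))) * nsq μ := by
  have hu : ∀ y, ‖phaseRatio (fine n M) T T' y‖ = 1 := norm_phaseRatio (fine n M) hT hT'
  have hnd : (0 : ℝ) ≤ (n : ℝ) ^ d := by positivity
  exact lipschitz_half (Qk := Qk n M T) (Qk' := Qk n M T') (Sc := Sc n M R) (Sc' := Sc n M R') (qW := qW n M) (qZ := nsq)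
    (rephase (fine n M) (phaseRatio (fine n M) T T')) (continuous_Qc T) (continuous_sum_dirU R _) (Sc_nonneg n M R)
    (Sc_nonneg n M R') (qW_nonneg n M) (fun μ => nsq_nonneg μ) hnd hΛ hCP (by positivity) (norm_sq_le_qW n M) hUB hP
    (Qk_rephase n M hT') (fun f => Sc_rephase_le n M hu hρ0 hρ f) μ

/-- **LEAF s8 — THE TWO-SIDED LIPSCHITZ BRACKET** (both halves; UB⁺/P⁺ for both backgrounds with common `Λ`, `C_P`; aligned-connection
numbers `ρ` (W′ read in W's frame) and `ρ′` (W read in W′'s frame)): `Δ′(W′)(μ) ≤ Δ′(W)(μ) + e(ρ)·nsq μ` and `Δ′(W)(μ) ≤ Δ′(W′)(μ) + e(ρ′)·nsq μ`,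
`e(ρ) = 2√d(nρ)√(Λ·C_P(Λ+1)) + d(nρ)²·C_P(Λ+1)`. [folklore] -/
theorem scalar_lipschitz_bracket {R R' : Tor (fine n M) → Fin d → ℂ} {T T' : Tor (fine n M) → ℂ}
    (hT : ∀ x, ‖T x‖ = 1) (hT' : ∀ x, ‖T' x‖ = 1) {ρ ρ' : ℝ} (hρ0 : 0 ≤ ρ) (hρ'0 : 0 ≤ ρ')
    (hρ : ∀ y μ, ‖aligned (fine n M) (phaseRatio (fine n M) T T') R' y μ - R y μ‖ ≤ ρ)
    (hρ' : ∀ y μ, ‖aligned (fine n M) (phaseRatio (fine n M) T' T) R y μ - R' y μ‖ ≤ ρ')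
    {Λ CP : ℝ} (hΛ : 0 ≤ Λ) (hCP : 0 ≤ CP)
    (hUB : ∀ μ : Tor M → ℂ, ∃ f, Qk n M T f = μ ∧ Sc n M R f ≤ Λ * nsq μ)
    (hP : ∀ f, qW n M f ≤ CP * (Sc n M R f + nsq (Qk n M T f)))
    (hUB' : ∀ μ : Tor M → ℂ, ∃ f, Qk n M T' f = μ ∧ Sc n M R' f ≤ Λ * nsq μ)
    (hP' : ∀ f, qW n M f ≤ CP * (Sc n M R' f + nsq (Qk n M T' f))) (μ : Tor M → ℂ) :
    blockSpin (Qk n M T') (Sc n M R') μ ≤ blockSpin (Qk n M T) (Sc n M R) μ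
        + (2 * (Real.sqrt d * ((n : ℝ) * ρ)) * Real.sqrt (Λ * (CP * (Λ + 1)))
            + (Real.sqrt d * ((n : ℝ) * ρ)) ^ 2 * (CP * (Λ + 1))) * nsq μ ∧
      blockSpin (Qk n M T) (Sc n M R) μ ≤ blockSpin (Qk n M T') (Sc n M R') μ
        + (2 * (Real.sqrt d * ((n : ℝ) * ρ')) * Real.sqrt (Λ * (CP * (Λ + 1)))
            + (Real.sqrt d * ((n : ℝ) * ρ')) ^ 2 * (CP * (Λ + 1))) * nsq μ :=
  ⟨scalar_lipschitz_half n M hT hT' hρ0 hρ hΛ hCP hUB hP μ, scalar_lipschitz_half n M hT' hT hρ'0 hρ' hΛ hCP hUB' hP' μ⟩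

/-- **LEAF s8, ONE HALF, WITH P⁺ DISCHARGED** from the owner's `qW_le_coarse` (global small-field frame `G`, block phases `c`, frame
defects `m_G`, `m_B` with `16d²(n m_G)² + 4m_B² ≤ ½` — the data of `scalar_pair_bracket`), `C_P = 1088d + 128`. [folklore] -/
theorem scalar_lipschitz_half_frame {R R' : Tor (fine n M) → Fin d → ℂ} {T T' G : Tor (fine n M) → ℂ} {c : Tor M → ℂ}
    (hT : ∀ x, ‖T x‖ = 1) (hT' : ∀ x, ‖T' x‖ = 1) {ρ : ℝ} (hρ0 : 0 ≤ ρ)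
    (hρ : ∀ y μ, ‖aligned (fine n M) (phaseRatio (fine n M) T T') R' y μ - R y μ‖ ≤ ρ)
    (hG : ∀ x, ‖G x‖ = 1) (hc : ∀ z, ‖c z‖ ≤ 1) {mG mB : ℝ}
    (hframe : ∀ x μ, ‖G (x + unitVec (fine n M) μ) - G x * R x μ‖ ≤ mG)
    (hblock : ∀ z j, ‖G (bpt n M z j) - c z * T (bpt n M z j)‖ ≤ mB)
    (hsmall : 16 * (d : ℝ) ^ 2 * ((n : ℝ) * mG) ^ 2 + 4 * mB ^ 2 ≤ 1 / 2)
    {Λ : ℝ} (hΛ : 0 ≤ Λ) (hUB : ∀ μ : Tor M → ℂ, ∃ f, Qk n M T f = μ ∧ Sc n M R f ≤ Λ * nsq μ) (μ : Tor M → ℂ) :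
    blockSpin (Qk n M T') (Sc n M R') μ ≤ blockSpin (Qk n M T) (Sc n M R) μ
      + (2 * (Real.sqrt d * ((n : ℝ) * ρ)) * Real.sqrt (Λ * ((1088 * d + 128) * (Λ + 1)))
          + (Real.sqrt d * ((n : ℝ) * ρ)) ^ 2 * ((1088 * d + 128) * (Λ + 1))) * nsq μ :=
  scalar_lipschitz_half n M hT hT' hρ0 hρ hΛ (by positivity) hUB (fun f => qW_le_coarse n M hG hc hframe hblock hsmall f) μ

/-- **LEAF s8 — THE SYMMETRIC TWO-SIDED BRACKET WITH ONE NUMBER `ρ`** (by `norm_aligned_symm` the reverse half needs no new datum):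
`|Δ′(W′)(μ) − Δ′(W)(μ)| ≤ (2δ√(Λ·C_P(Λ+1)) + δ²·C_P(Λ+1))·nsq μ`, `δ = √d·(n·ρ)`. [folklore] -/
theorem scalar_lipschitz_abs {R R' : Tor (fine n M) → Fin d → ℂ} {T T' : Tor (fine n M) → ℂ}
    (hT : ∀ x, ‖T x‖ = 1) (hT' : ∀ x, ‖T' x‖ = 1) {ρ : ℝ} (hρ0 : 0 ≤ ρ)
    (hρ : ∀ y μ, ‖aligned (fine n M) (phaseRatio (fine n M) T T') R' y μ - R y μ‖ ≤ ρ)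
    {Λ CP : ℝ} (hΛ : 0 ≤ Λ) (hCP : 0 ≤ CP)
    (hUB : ∀ μ : Tor M → ℂ, ∃ f, Qk n M T f = μ ∧ Sc n M R f ≤ Λ * nsq μ)
    (hP : ∀ f, qW n M f ≤ CP * (Sc n M R f + nsq (Qk n M T f)))
    (hUB' : ∀ μ : Tor M → ℂ, ∃ f, Qk n M T' f = μ ∧ Sc n M R' f ≤ Λ * nsq μ)
    (hP' : ∀ f, qW n M f ≤ CP * (Sc n M R' f + nsq (Qk n M T' f))) (μ : Tor M → ℂ) :
    |blockSpin (Qk n M T') (Sc n M R') μ - blockSpin (Qk n M T) (Sc n M R) μ|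
      ≤ (2 * (Real.sqrt d * ((n : ℝ) * ρ)) * Real.sqrt (Λ * (CP * (Λ + 1)))
          + (Real.sqrt d * ((n : ℝ) * ρ)) ^ 2 * (CP * (Λ + 1))) * nsq μ := by
  have hρ' : ∀ y μ, ‖aligned (fine n M) (phaseRatio (fine n M) T' T) R y μ - R' y μ‖ ≤ ρ := fun y μ => by
    rw [norm_aligned_symm (fine n M) hT hT']; exact hρ y μ
  obtain ⟨h1, h2⟩ := scalar_lipschitz_bracket n M hT hT' hρ0 hρ0 hρ hρ' hΛ hCP hUB hP hUB' hP' μ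
  rw [abs_le]
  constructor <;> linarith

/-- **LEAF s8 IN THE CONSUMER's CURRENCY (op-norm), GIVEN THE MATRIX READING** (supplier leaf s1, displayed): if Hermitian matrices `X`, `X′`
represent the two effective actions as forms (`re ⟨μ, X μ⟩ = Δ′(W)(μ)`, `re ⟨μ, X′ μ⟩ = Δ′(W′)(μ)`) and the two-sided bracket holds with a
common number `e ≥ 0`, then `‖X′ − X‖ ≤ e`. [folklore] -/
theorem opNorm_lipschitz {ι : Type*} [Fintype ι] [DecidableEq ι] {X X' : Matrix ι ι ℂ} (hX : X.IsHermitian) (hX' : X'.IsHermitian)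
    {Δ Δ' : (ι → ℂ) → ℝ} (hXΔ : ∀ μ, (star μ ⬝ᵥ (X *ᵥ μ)).re = Δ μ) (hXΔ' : ∀ μ, (star μ ⬝ᵥ (X' *ᵥ μ)).re = Δ' μ)
    {e : ℝ} (he : 0 ≤ e) (hup : ∀ μ, Δ' μ ≤ Δ μ + e * nsq μ) (hlow : ∀ μ, Δ μ ≤ Δ' μ + e * nsq μ) : ‖X' - X‖ ≤ e := by
  refine opNorm_sub_le_of_form_abs hX hX' he (fun v => ?_) (fun v => ?_)
  · rw [hXΔ, hXΔ']; exact hup v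
  · rw [hXΔ, hXΔ']; exact hlow v

/-- **LEAF s8, CONSUMER's CURRENCY ON THE SCALAR CARRIERS**: with Hermitian matrices `X`, `X′` READING the two effective actions
(`re ⟨μ, X μ⟩ = T_{Q_T}Sc_R(μ)`, `re ⟨μ, X′ μ⟩ = T_{Q_{T′}}Sc_{R′}(μ)` — supplier leaf s1, displayed) and the data of `scalar_lipschitz_abs`:
`‖X′ − X‖ ≤ 2√d(nρ)√(Λ·C_P(Λ+1)) + d(nρ)²·C_P(Λ+1)`.  This is the L-LIP factor of the two-runs face; `n·ρ` is the number node NE3 is asked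
about (its `LocalRate` reading is NOT asserted here). [folklore] -/
theorem opNorm_scalar_lipschitz {R R' : Tor (fine n M) → Fin d → ℂ} {T T' : Tor (fine n M) → ℂ}
    (hT : ∀ x, ‖T x‖ = 1) (hT' : ∀ x, ‖T' x‖ = 1) {ρ : ℝ} (hρ0 : 0 ≤ ρ)
    (hρ : ∀ y μ, ‖aligned (fine n M) (phaseRatio (fine n M) T T') R' y μ - R y μ‖ ≤ ρ)
    {Λ CP : ℝ} (hΛ : 0 ≤ Λ) (hCP : 0 ≤ CP)
    (hUB : ∀ μ : Tor M → ℂ, ∃ f, Qk n M T f = μ ∧ Sc n M R f ≤ Λ * nsq μ)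
    (hP : ∀ f, qW n M f ≤ CP * (Sc n M R f + nsq (Qk n M T f)))
    (hUB' : ∀ μ : Tor M → ℂ, ∃ f, Qk n M T' f = μ ∧ Sc n M R' f ≤ Λ * nsq μ)
    (hP' : ∀ f, qW n M f ≤ CP * (Sc n M R' f + nsq (Qk n M T' f)))
    {X X' : Matrix (Tor M) (Tor M) ℂ} (hX : X.IsHermitian) (hX' : X'.IsHermitian)
    (hXΔ : ∀ μ, (star μ ⬝ᵥ (X *ᵥ μ)).re = blockSpin (Qk n M T) (Sc n M R) μ)
    (hXΔ' : ∀ μ, (star μ ⬝ᵥ (X' *ᵥ μ)).re = blockSpin (Qk n M T') (Sc n M R') μ) :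
    ‖X' - X‖ ≤ 2 * (Real.sqrt d * ((n : ℝ) * ρ)) * Real.sqrt (Λ * (CP * (Λ + 1)))
        + (Real.sqrt d * ((n : ℝ) * ρ)) ^ 2 * (CP * (Λ + 1)) := by
  have hρ' : ∀ y μ, ‖aligned (fine n M) (phaseRatio (fine n M) T' T) R y μ - R' y μ‖ ≤ ρ := fun y μ => by
    rw [norm_aligned_symm (fine n M) hT hT']; exact hρ y μ
  have he : 0 ≤ 2 * (Real.sqrt d * ((n : ℝ) * ρ)) * Real.sqrt (Λ * (CP * (Λ + 1)))
      + (Real.sqrt d * ((n : ℝ) * ρ)) ^ 2 * (CP * (Λ + 1)) := by positivity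
  refine opNorm_lipschitz hX hX' hXΔ hXΔ' he (fun ν => ?_) (fun ν => ?_)
  · exact scalar_lipschitz_half n M hT hT' hρ0 hρ hΛ hCP hUB hP ν
  · exact scalar_lipschitz_half n M hT' hT hρ0 hρ' hΛ hCP hUB' hP' ν

end LevelN

end Summit.QuantumFields.BalabanUV.T4Continuum.VariationalCovariantLipschitz

end
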